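import Summits.Ventures.LatticeQCDFlow.Scoring.SchwingerDysonSpectralOracle
import Mathlib.Analysis.SpecialFunctions.Trigonometric.Inverse
import HarnessLib

/-!
# Leapfrog HMC on the free field: exact mode decoupling, the shadow energy, and the proposal's rotation law

HONEST FRAMING: exact (Metropolis-corrected) sampling algorithms for lattice gauge theory;
figures of merit are autocorrelation/cost numbers at stated couplings and volumes; no
continuum-physics claim.  (SCALAR calibration rung S0-A: not a gauge result.)

Venture `LatticeQCDFlow` (cell pub-lqcd), sub-topic `Scoring`; FANOUT row 2 (`s0-phi4`: the HMC
comparator of the 2D φ⁴ calibration, `latflow.core` qpq leapfrog).  NEW WORK of the cell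
(elementary algebra and trigonometry over Mathlib); nothing is cited as a fact.  Printed
counterparts, named only: Duane–Kennedy–Pendleton–Roweth 1987 (HMC); Kennedy–Pendleton 1991
(Nucl. Phys. B Proc. Suppl. 20, 118: acceptances and autocorrelations of HMC on the Gaussian
model, mode by mode); Leimkuhler–Reich 2004 ch. 5 / Hairer–Lubich–Wanner (the modified /
shadow Hamiltonian of the Störmer–Verlet method, exact for quadratic Hamiltonians).

The exactness of Metropolis-corrected leapfrog HMC is `Exactness/SplittingIntegrator.lean` +
`Exactness/InvolutiveMetropolis.lean` (row 9 / row 30).  This file is the free-field CALIBRATION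
THEORY of the proposal: what one trajectory does to each Fourier mode, exactly.

## What is proved

* `lfDrift`, `lfKick`, `leapfrogQPQ J λ δ` — the engine's drift–kick–drift step for
  `H = S(φ) + Σ p²/2`, `S = ΣφJφ + λΣφ⁴` (`latticePhi4Force` = `∂S/∂φ`); `linear_lfDrift`,
  `linear_lfKick` (linear observables through the sub-steps).
* `lfMode δ Ω²` — the 2 × 2 map `(O, P) ↦ ((1 − δ²Ω²/2)O + δ(1 − δ²Ω²/4)P, −δΩ²O + (1 − δ²Ω²/2)P)`;
  **`leapfrog_mode`** / `leapfrog_iterate_mode` — for the FREE field (`λ = 0`,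
  `J = shiftCoupling σ m²`) and every eigenmode `b` of `−Δ_lat` (eigenvalue `κ`), the pair
  `(b·φ, b·p)` evolves AUTONOMOUSLY by `lfMode δ Ω_κ²`, `Ω_κ² = 2(κ + m²)`, along any number of steps
  (summation by parts `sum_mul_force_shift_of_eigen`): leapfrog decouples mode by mode exactly.
* `lfMode_det` (area `1`: Liouville per mode); **`lfMode_shadow`** / `lfMode_iterate_shadow` — the
  SHADOW ENERGY `H̃ = ½(Ω²O² + (1 − δ²Ω²/4)P²)` is conserved EXACTLY by every step, hence along the
  trajectory; **`lfMode_energy_violation`** / `lfMode_iterate_energy_violation` — the energy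
  violation the accept step sees is, in closed form, `H_N − H_0 = (δ²Ω²/8)(P_N² − P_0²)` per mode:
  `O(δ²)`, bounded uniformly in the trajectory length `N`, no secular drift.
* **`lfMode_iterate_rotation`** — in the stable regime `δ²Ω² < 4`, with `cos θ = 1 − δ²Ω²/2`
  (`θ = arccos`) and `β = δ(1 − δ²Ω²/4)/sin θ`, `N` steps are
  `(O, P) ↦ (cos(Nθ)O + β sin(Nθ)P, −β⁻¹ sin(Nθ)O + cos(Nθ)P)` (induction with the addition
  formulas); `leapfrog_stable_of_step` — `δ²(4d + m²) < 2` puts EVERY lattice mode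
  (`κ ≤ 4d`) in the stable regime (the free-field step-size ceiling; `d = 2`, small `m²`: `δ < 1/2`).
* **`leapfrog_proposal_mean`** — refresh the momenta from ANY centred law `ν` (probability
  measure with integrable, mean-zero coordinates; the engine's `N(0,1)^Λ`) and run `N` stable
  steps: the proposed mode observable has conditional mean
  `E[b·φ_N | φ] = cos(Nθ_κ) · b·φ`.  Reading (Kennedy–Pendleton): at acceptance → 1 (small `δ`,
  `Nδ = T`, `Nθ_κ → Ω_κT`) each mode of the HMC chain is an AR(1) series with coefficient
  `cos(Ω_κ T)`; the slowest, `Ω_0 = √(2m²)` (the magnetisation), has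
  `1 − cos(Ω_0T) ≈ m²T²` so at FIXED trajectory length `τ_int ∝ ξ₂²/T²` trajectories — `z = 2` —
  while `T ∝ ξ` gives `z = 1` and hits the resonances `Ω_κT ∈ 2πℤ` of the other modes (the case
  for randomised `T`); this reading is the dictionary for S0-A's fitted HMC exponents and is NOT
  a theorem here (the accept/reject step makes the exact chain's regression nonlinear).

NOT CLAIMED: anything about the Metropolis-corrected chain's autocorrelations; `λ > 0`; the pqp
variant (same algebra with `O ↔ P` roles of the half steps); acceptance-rate asymptotics
(`erfc`, cf. `Literature/Probability/Distributions/GaussianMetropolisAcceptance.lean`).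
-/

namespace Summit.Ventures.LatticeQCDFlow.Scoring

open Real Finset MeasureTheory

/-! ## The qpq leapfrog step of the engine -/

section Leapfrog

variable {Λ : Type*} [Fintype Λ]

/-- A position DRIFT by time `τ`: `φ ← φ + τ p`. -/
def lfDrift (τ : ℝ) (φ p : Λ → ℝ) : Λ → ℝ := fun x => φ x + τ * p x

/-- A momentum KICK by step `δ` with the φ⁴ force `F = ∂S/∂φ` (`latticePhi4Force J λ`):
`p ← p − δ F(φ)`. -/
noncomputable def lfKick (J : Λ → Λ → ℝ) (lam δ : ℝ) (φ p : Λ → ℝ) : Λ → ℝ :=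
  fun x => p x - δ * latticePhi4Force J lam φ x

/-- **One qpq ("drift–kick–drift") leapfrog step** of size `δ` for `H = S(φ) + Σ p²/2`
(`latflow.core` HMC primary integrator; the pqp variant swaps the roles of the half steps). -/
noncomputable def leapfrogQPQ (J : Λ → Λ → ℝ) (lam δ : ℝ) (z : (Λ → ℝ) × (Λ → ℝ)) :
    (Λ → ℝ) × (Λ → ℝ) :=
  (lfDrift (δ / 2) (lfDrift (δ / 2) z.1 z.2) (lfKick J lam δ (lfDrift (δ / 2) z.1 z.2) z.2),
    lfKick J lam δ (lfDrift (δ / 2) z.1 z.2) z.2)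

/-- A linear observable commutes with the drift: `b·(φ + τp) = b·φ + τ b·p`. -/
theorem linear_lfDrift (b : Λ → ℝ) (τ : ℝ) (φ p : Λ → ℝ) :
    ∑ y, b y * lfDrift τ φ p y = (∑ y, b y * φ y) + τ * ∑ y, b y * p y := by
  simp only [lfDrift, mul_add, Finset.sum_add_distrib, Finset.mul_sum]
  congr 1
  exact Finset.sum_congr rfl fun y _ => by ring

/-- A linear observable of the kick: `b·(p − δF) = b·p − δ Σ_x b_x F_x`. -/
theorem linear_lfKick (b : Λ → ℝ) (J : Λ → Λ → ℝ) (lam δ : ℝ) (φ p : Λ → ℝ) :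
    ∑ y, b y * lfKick J lam δ φ p y
      = (∑ y, b y * p y) - δ * ∑ y, b y * latticePhi4Force J lam φ y := by
  simp only [lfKick, mul_sub, Finset.sum_sub_distrib, Finset.mul_sum]
  congr 1
  exact Finset.sum_congr rfl fun y _ => by ring

end Leapfrog

/-! ## The 2 × 2 mode map -/

section Mode

/-- The leapfrog step seen by ONE normal mode of squared frequency `w2 = Ω²` (harmonic force
`Ω² O`): `(O, P) ↦ ((1 − δ²Ω²/2) O + δ(1 − δ²Ω²/4) P, −δΩ² O + (1 − δ²Ω²/2) P)`. -/
noncomputable def lfMode (δ w2 : ℝ) (z : ℝ × ℝ) : ℝ × ℝ :=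
  ((1 - δ ^ 2 * w2 / 2) * z.1 + δ * (1 - δ ^ 2 * w2 / 4) * z.2,
    -δ * w2 * z.1 + (1 - δ ^ 2 * w2 / 2) * z.2)

/-- **Area preservation**: the mode map has determinant `1` (Liouville, mode by mode). -/
theorem lfMode_det (δ w2 : ℝ) :
    (1 - δ ^ 2 * w2 / 2) * (1 - δ ^ 2 * w2 / 2) - (δ * (1 - δ ^ 2 * w2 / 4)) * (-δ * w2) = 1 := by
  ring

/-- **The shadow energy is conserved EXACTLY**: `H̃ = ½(Ω² O² + (1 − δ²Ω²/4) P²)` is invariant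
under the mode map, for every step size. -/
theorem lfMode_shadow (δ w2 : ℝ) (z : ℝ × ℝ) :
    w2 * (lfMode δ w2 z).1 ^ 2 + (1 - δ ^ 2 * w2 / 4) * (lfMode δ w2 z).2 ^ 2
      = w2 * z.1 ^ 2 + (1 - δ ^ 2 * w2 / 4) * z.2 ^ 2 := by
  simp only [lfMode]
  ring

/-- **The energy violation of one step in closed form**: with the mode energy
`H = ½(Ω² O² + P²)`, `H' − H = (δ²Ω²/8)(P'² − P²)`. -/
theorem lfMode_energy_violation (δ w2 : ℝ) (z : ℝ × ℝ) :
    (w2 * (lfMode δ w2 z).1 ^ 2 + (lfMode δ w2 z).2 ^ 2) / 2 - (w2 * z.1 ^ 2 + z.2 ^ 2) / 2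
      = δ ^ 2 * w2 / 8 * ((lfMode δ w2 z).2 ^ 2 - z.2 ^ 2) := by
  have h := lfMode_shadow δ w2 z
  linear_combination h / 2

/-- The shadow energy is conserved along the whole trajectory. -/
theorem lfMode_iterate_shadow (δ w2 : ℝ) (z : ℝ × ℝ) (N : ℕ) :
    w2 * ((lfMode δ w2)^[N] z).1 ^ 2 + (1 - δ ^ 2 * w2 / 4) * ((lfMode δ w2)^[N] z).2 ^ 2
      = w2 * z.1 ^ 2 + (1 - δ ^ 2 * w2 / 4) * z.2 ^ 2 := by
  induction N with
  | zero => simp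
  | succ N ih =>
      rw [Function.iterate_succ_apply', lfMode_shadow, ih]

/-- **Energy violation of an `N`-step trajectory, exactly**: `H_N − H_0 = (δ²Ω²/8)(P_N² − P_0²)`
— bounded by `(δ²Ω²/8) P_N²` whatever `N`, which is why leapfrog HMC on a Gaussian never drifts. -/
theorem lfMode_iterate_energy_violation (δ w2 : ℝ) (z : ℝ × ℝ) (N : ℕ) :
    (w2 * ((lfMode δ w2)^[N] z).1 ^ 2 + ((lfMode δ w2)^[N] z).2 ^ 2) / 2
        - (w2 * z.1 ^ 2 + z.2 ^ 2) / 2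
      = δ ^ 2 * w2 / 8 * (((lfMode δ w2)^[N] z).2 ^ 2 - z.2 ^ 2) := by
  have h := lfMode_iterate_shadow δ w2 z N
  linear_combination h / 2

/-- **Rotation form of the trajectory.**  In the stable regime `δ²Ω² < 4` put
`cos θ = 1 − δ²Ω²/2` (`θ = arccos`, `sin θ = δΩ·√(1 − δ²Ω²/4) > 0`) and `β = δ(1 − δ²Ω²/4)/sin θ`;
then `N` leapfrog steps are the "rotation"
`(O, P) ↦ (cos(Nθ) O + β sin(Nθ) P, −β⁻¹ sin(Nθ) O + cos(Nθ) P)`. -/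
theorem lfMode_iterate_rotation (δ w2 : ℝ) (hδ : 0 < δ) (hw : 0 < w2) (hst : δ ^ 2 * w2 < 4)
    (z : ℝ × ℝ) (N : ℕ) :
    let θ := Real.arccos (1 - δ ^ 2 * w2 / 2)
    let β := δ * (1 - δ ^ 2 * w2 / 4) / Real.sin θ
    (lfMode δ w2)^[N] z
      = (Real.cos (N * θ) * z.1 + β * Real.sin (N * θ) * z.2,
          -(Real.sin (N * θ) / β) * z.1 + Real.cos (N * θ) * z.2) := by
  intro θ β
  -- the angle
  have ha1 : -1 ≤ 1 - δ ^ 2 * w2 / 2 := by nlinarith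
  have ha2 : 1 - δ ^ 2 * w2 / 2 ≤ 1 := by nlinarith
  have hcos : Real.cos θ = 1 - δ ^ 2 * w2 / 2 := Real.cos_arccos ha1 ha2
  have hsin2 : Real.sin θ ^ 2 = δ ^ 2 * w2 * (1 - δ ^ 2 * w2 / 4) := by
    have := Real.sin_sq_add_cos_sq θ
    rw [hcos] at this
    nlinarith
  have hq : 0 < 1 - δ ^ 2 * w2 / 4 := by nlinarith
  have hsin_pos : 0 < Real.sin θ := by
    have hne : Real.sin θ ≠ 0 := by
      intro h0
      rw [h0] at hsin2
      have : 0 < δ ^ 2 * w2 * (1 - δ ^ 2 * w2 / 4) := by positivity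
      linarith
    rcases lt_or_gt_of_ne hne with h | h
    · exfalso
      have := Real.sin_arccos (1 - δ ^ 2 * w2 / 2)
      have hnn : 0 ≤ Real.sin θ := by rw [this]; exact Real.sqrt_nonneg _
      linarith
    · exact h
  have hβ : β * Real.sin θ = δ * (1 - δ ^ 2 * w2 / 4) := by
    show δ * (1 - δ ^ 2 * w2 / 4) / Real.sin θ * Real.sin θ = _
    rw [div_mul_cancel₀ _ hsin_pos.ne']
  have hβ0 : β ≠ 0 := by
    intro h0
    rw [h0, zero_mul] at hβ
    have : 0 < δ * (1 - δ ^ 2 * w2 / 4) := by positivity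
    linarith
  -- the off-diagonal entries in rotation form
  have hb : δ * (1 - δ ^ 2 * w2 / 4) = β * Real.sin θ := hβ.symm
  have hkey : Real.sin θ = δ * w2 * β := by
    have h1 : Real.sin θ * Real.sin θ = δ * w2 * β * Real.sin θ := by
      rw [mul_assoc (δ * w2), hβ, ← pow_two, hsin2]
      ring
    exact mul_right_cancel₀ hsin_pos.ne' h1
  have hc : -δ * w2 = -(Real.sin θ / β) := by
    rw [hkey]
    field_simp
  induction N with
  | zero =>
      simp
  | succ N ih =>
      rw [Function.iterate_succ_apply', ih]
      simp only [lfMode, Nat.cast_succ, add_mul, one_mul, Real.cos_add, Real.sin_add]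
      rw [← hcos]
      refine Prod.ext ?_ ?_
      · simp only []
        rw [hb]
        field_simp
        ring
      · simp only []
        rw [hc]
        field_simp
        ring

end Mode

/-! ## The engine's free field: leapfrog decouples into modes -/

section Shift

variable {n : ℕ} {ι : Type*} [Fintype ι]

/-- **Exact mode decoupling of the leapfrog step** for the free action (`λ = 0`,
`J = shiftCoupling σ m²`): for every eigenmode `b` of `−Δ_lat` (eigenvalue `κ`) the pair
`(O, P) = (b·φ, b·p)` is mapped by `lfMode δ Ω²` with `Ω² = 2(κ + m²)`, whatever the other modes
do. -/
theorem leapfrog_mode (σ : ι → Equiv.Perm (Fin (n + 1))) (m2 δ : ℝ) {b : Fin (n + 1) → ℝ} {κ : ℝ}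
    (hb : ∀ x, ∑ μ, (2 * b x - b (σ μ x) - b ((σ μ).symm x)) = κ * b x)
    (φ p : Fin (n + 1) → ℝ) :
    ((∑ y, b y * (leapfrogQPQ (shiftCoupling σ m2) 0 δ (φ, p)).1 y),
      (∑ y, b y * (leapfrogQPQ (shiftCoupling σ m2) 0 δ (φ, p)).2 y))
      = lfMode δ (2 * (κ + m2)) (∑ y, b y * φ y, ∑ y, b y * p y) := by
  have hF : ∀ ψ : Fin (n + 1) → ℝ, ∑ y, b y * latticePhi4Force (shiftCoupling σ m2) 0 ψ y
      = 2 * (κ + m2) * ∑ y, b y * ψ y := by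
    intro ψ
    rw [sum_mul_force_shift_of_eigen σ m2 0 hb ψ]
    ring
  simp only [leapfrogQPQ, linear_lfDrift, linear_lfKick, hF, lfMode, Prod.mk.injEq]
  constructor <;> ring

/-- **`N` leapfrog steps, mode by mode**: the projection of the trajectory is the `N`-th iterate
of the mode map. -/
theorem leapfrog_iterate_mode (σ : ι → Equiv.Perm (Fin (n + 1))) (m2 δ : ℝ)
    {b : Fin (n + 1) → ℝ} {κ : ℝ}
    (hb : ∀ x, ∑ μ, (2 * b x - b (σ μ x) - b ((σ μ).symm x)) = κ * b x) (N : ℕ)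
    (z : (Fin (n + 1) → ℝ) × (Fin (n + 1) → ℝ)) :
    ((∑ y, b y * ((leapfrogQPQ (shiftCoupling σ m2) 0 δ)^[N] z).1 y),
      (∑ y, b y * ((leapfrogQPQ (shiftCoupling σ m2) 0 δ)^[N] z).2 y))
      = (lfMode δ (2 * (κ + m2)))^[N] (∑ y, b y * z.1 y, ∑ y, b y * z.2 y) := by
  induction N with
  | zero => simp
  | succ N ih =>
      rw [Function.iterate_succ_apply', Function.iterate_succ_apply', ← ih]
      exact leapfrog_mode σ m2 δ hb _ _

/-- **The HMC proposal's mean is a rotation of the mode.**  Refresh the momenta from ANY centred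
law `ν` (a probability measure on `ℝ^Λ` with `∫ p_y dν = 0` and integrable coordinates — the
engine's `p ∼ N(0, 1)^Λ`), run `N` leapfrog steps of size `δ` in the stable regime
`δ² Ω_κ² < 4`: the proposed value of the mode observable has conditional mean
`E[b·φ_N | φ] = cos(N θ_κ) · b·φ`, `cos θ_κ = 1 − δ²Ω_κ²/2`, `Ω_κ² = 2(κ + m²)`. -/
theorem leapfrog_proposal_mean (σ : ι → Equiv.Perm (Fin (n + 1))) {m2 δ : ℝ} (hδ : 0 < δ)
    {b : Fin (n + 1) → ℝ} {κ : ℝ}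
    (hb : ∀ x, ∑ μ, (2 * b x - b (σ μ x) - b ((σ μ).symm x)) = κ * b x)
    (hκ : 0 < κ + m2) (hst : δ ^ 2 * (2 * (κ + m2)) < 4) (N : ℕ)
    (ν : Measure (Fin (n + 1) → ℝ)) [IsProbabilityMeasure ν]
    (hint : ∀ y, Integrable (fun p : Fin (n + 1) → ℝ => p y) ν)
    (hmean : ∀ y, ∫ p, p y ∂ν = 0) (φ : Fin (n + 1) → ℝ) :
    ∫ p, (∑ y, b y * ((leapfrogQPQ (shiftCoupling σ m2) 0 δ)^[N] (φ, p)).1 y) ∂ν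
      = Real.cos (N * Real.arccos (1 - δ ^ 2 * (2 * (κ + m2)) / 2)) * ∑ y, b y * φ y := by
  have hw : 0 < 2 * (κ + m2) := by linarith
  have hrot := lfMode_iterate_rotation δ (2 * (κ + m2)) hδ hw hst
  have hpt : ∀ p : Fin (n + 1) → ℝ,
      (∑ y, b y * ((leapfrogQPQ (shiftCoupling σ m2) 0 δ)^[N] (φ, p)).1 y)
        = Real.cos (N * Real.arccos (1 - δ ^ 2 * (2 * (κ + m2)) / 2)) * ∑ y, b y * φ y
          + (δ * (1 - δ ^ 2 * (2 * (κ + m2)) / 4)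
              / Real.sin (Real.arccos (1 - δ ^ 2 * (2 * (κ + m2)) / 2))
              * Real.sin (N * Real.arccos (1 - δ ^ 2 * (2 * (κ + m2)) / 2)))
            * ∑ y, b y * p y := by
    intro p
    have h := congrArg Prod.fst (leapfrog_iterate_mode σ m2 δ hb N (φ, p))
    simp only [] at h
    rw [h, hrot (∑ y, b y * φ y, ∑ y, b y * p y) N]
  simp only [hpt]
  have hI : Integrable (fun p : Fin (n + 1) → ℝ => ∑ y, b y * p y) ν :=
    integrable_finsetSum _ fun y _ => (hint y).const_mul (b y)
  rw [integral_add (integrable_const _) (hI.const_mul _), integral_const, integral_const_mul,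
    integral_finsetSum _ (fun y _ => (hint y).const_mul (b y))]
  simp only [integral_const_mul, hmean, mul_zero, Finset.sum_const_zero, smul_eq_mul,
    probReal_univ, one_mul, add_zero]

/-- **Stability bound.**  The mode map is a rotation (bounded trajectories) iff `δ²Ω² < 4`; on the
lattice `Ω² = 2(κ + m²) ≤ 2(4d + m²)`, so `δ² (4d + m²) < 2` makes EVERY mode stable — the
free-field step-size ceiling of leapfrog (`d = 2`, small `m²`: `δ < 1/2`). -/
theorem leapfrog_stable_of_step (d : ℕ) (m2 κ δ : ℝ) (hκ : κ ≤ 4 * d)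
    (hδ : δ ^ 2 * (4 * d + m2) < 2) :
    δ ^ 2 * (2 * (κ + m2)) < 4 := by
  have hδ2 : 0 ≤ δ ^ 2 := sq_nonneg δ
  nlinarith

end Shift

end Summit.Ventures.LatticeQCDFlow.Scoring
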